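import Summits.BirchSwinnertonDyer.BirchSwinnertonDyer.Theorems.EisensteinPrimesMazurMCOnX1RankZeroInterludeCoreDescentXI0
import Summits.BirchSwinnertonDyer.BirchSwinnertonDyer.Theorems.EisensteinPrimesMazurMCOnX1RankZeroInterludeK2PlusOfFW
import HarnessLib

/-!
# Crux `MazurMCOnX1RankZero` (item stmt-BirchSwinnertonDyer-19035), line `interlude_with_torsion` — the crux BY NAME from the v14 stub
# types: ONE print bundle (PUB ×15 ∧ Ferrero–Washington), crux 2, and the PRE door XI° (CONDITIONAL closure)

Cell `bsd-eis` (host `run/shared/lean/pub/bsd-eis/`), seat `bsd-eis-lam-a` g21 (PART 1b seat (4); `--supports`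
stmt-BirchSwinnertonDyer-19035 as a HELPER; no claim, closes nothing by itself).

The tree's conditional closure of record `mazurMCOnX1RankZero_of_stubs_xi0` (`…InterludeCoreDescentXI0`, p697211) takes FIVE hypotheses =
the v13 stub types: the PUB bundle, crux 2, XI°, road B's (B3) `ResidualGL1FinitenessOdd` and (B1c) `RoadBResidueP`. Since (B1c) is the tree
theorem `stub_roadBResidueP` (p687195) and (B3) now follows from the Ferrero–Washington theorem ALONE
(`RoadBOfFW.residualGL1FinitenessOdd_of_ferreroWashington`, p723558 — through U = p694611, Greenberg's Lemma 5.9 ⟸ FW = p717721, the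
[Even] plug p721873), the closure needs only THREE hypotheses — exactly the stub types of the host-vetted v14 candidate of the skeleton
(VARIANT-N: ONE cite stub `stub_printInputs : (PUB ×15) ∧ FW`, `stub_goodLatticeBDPValue`, `stub_crossTransferSomeLattice`):

* `mazurMCOnX1RankZero_of_printInputs_xi0` — crux 5 BY NAME from `(PublishedFacts ∧ PublishedFactsII ∧ CGS Prop. 3.4.2 ∧ KO Prop. 2.9)
  ∧ FW`, crux 2 and XI°;
* `mazurMCOnX1RankZero_of_ferreroWashington_pub_crux2_xi0` — the same, curried (FW first).

By-name accounting it records: **crux 5 ⟸ PUB ×16 (15 research-refereed named facts + Ferrero–Washington) ∧ crux 2 (`GoodLatticeBDPValue`,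
item -19032) ∧ XI° (`CrossTransferAtSomeLattice`, PRE: CGS Prop. 4.2.1 ⇐ Cor. 4.1.3 ⇐ Thm. 4.1.1 ⇐ BSTW24 §5)**. CONDITIONAL — nothing
about BSD, Mazur's main conjecture or IMC2 is proved here; 0 cells / labels / tiers move.
[cite: CastellaGrossiSkinner2025, §5 (Interlude), Prop. 4.2.1] [cite: KellerYin2024, Thm. 3.0.8] [cite: GreenbergLNM1716, §5 Lemma 5.9, Prop. 5.10]
[cite: FerreroWashington1979, Theorem]
-/

noncomputable section

set_option linter.dupNamespace false
set_option autoImplicit false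

open Literature.NumberTheory.EllipticCurves Literature.NumberTheory.IwasawaTheory

namespace Summit.BirchSwinnertonDyer.BirchSwinnertonDyer.Theorems.InterludeWithTorsion

/-- **Crux 5 `MazurMCOnX1RankZero` BY NAME from the THREE v14 stub types** — the print bundle `(PublishedFacts ∧ PublishedFactsII ∧
CGS Prop. 3.4.2 ∧ Kobayashi–Ota Prop. 2.9) ∧ Ferrero–Washington`, the route's crux 2 `GoodLatticeBDPValue`, and the PRE door XI°
`PublishedFacts → PublishedFactsII → CrossTransferAtSomeLattice` — by `mazurMCOnX1RankZero_of_stubs_xi0` (p697211) with road B's (B3)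
supplied from FW alone (`RoadBOfFW.residualGL1FinitenessOdd_of_ferreroWashington`, p723558) and (B1c) by the tree theorem
`stub_roadBResidueP` (p687195). CONDITIONAL; BSD / Mazur's MC / IMC2 are NOT proved by this theorem.
[cite: CastellaGrossiSkinner2025, §5 (Interlude), Prop. 4.2.1] [cite: KellerYin2024, Thm. 3.0.8] [cite: GreenbergLNM1716, §5 Prop. 5.10]
[cite: FerreroWashington1979, Theorem] -/
theorem mazurMCOnX1RankZero_of_printInputs_xi0
    (hPrint : (PublishedFacts ∧ PublishedFactsII ∧
        CastellaGrossiSkinner2025.prop342_twoLineEulerChar_trivialChar ∧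
        KobayashiOta2020.prop29_charIdeal_XGr_anticyclotomic_eq_of_isIsogenous) ∧
      ferreroWashington1979_classicalMuVanishes)
    (h2 : Summit.BirchSwinnertonDyer.BirchSwinnertonDyer.Theses.EisensteinPrimes.GoodLatticeBDPValue)
    (hXI0 : PublishedFacts → PublishedFactsII → CrossTransferAtSomeLattice) :
    Summit.BirchSwinnertonDyer.BirchSwinnertonDyer.Theses.EisensteinPrimes.MazurMCOnX1RankZero :=
  mazurMCOnX1RankZero_of_stubs_xi0 hPrint.1 h2 hXI0
    (RoadBOfFW.residualGL1FinitenessOdd_of_ferreroWashington hPrint.2) stub_roadBResidueP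

/-- **Crux 5 BY NAME, curried form**: Ferrero–Washington → the PUB ×15 bundle → crux 2 → XI° → `MazurMCOnX1RankZero`. Same proof.
CONDITIONAL; BSD / Mazur's MC / IMC2 are NOT proved by this theorem. [cite: FerreroWashington1979, Theorem]
[cite: CastellaGrossiSkinner2025, §5 (Interlude), Prop. 4.2.1] [cite: KellerYin2024, Thm. 3.0.8] -/
theorem mazurMCOnX1RankZero_of_ferreroWashington_pub_crux2_xi0
    (hFW : ferreroWashington1979_classicalMuVanishes)
    (hPub : PublishedFacts ∧ PublishedFactsII ∧
      CastellaGrossiSkinner2025.prop342_twoLineEulerChar_trivialChar ∧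
      KobayashiOta2020.prop29_charIdeal_XGr_anticyclotomic_eq_of_isIsogenous)
    (h2 : Summit.BirchSwinnertonDyer.BirchSwinnertonDyer.Theses.EisensteinPrimes.GoodLatticeBDPValue)
    (hXI0 : PublishedFacts → PublishedFactsII → CrossTransferAtSomeLattice) :
    Summit.BirchSwinnertonDyer.BirchSwinnertonDyer.Theses.EisensteinPrimes.MazurMCOnX1RankZero :=
  mazurMCOnX1RankZero_of_printInputs_xi0 ⟨hPub, hFW⟩ h2 hXI0

end Summit.BirchSwinnertonDyer.BirchSwinnertonDyer.Theorems.InterludeWithTorsion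

end
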